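/-
Copyright (c) 2026 the pub-hodgecm-mathlib formalisation cell (harness21).  Prover seat hodgecm-mathlib-LH1-p01 (g5): line LH1 (chair LH1-plan (g4)),
deal (C4) «CERT ED. 4» — the equivalence certificate of LEAF ED. 4 «Kompakt»; 2026-09-02.
-/
import Summits.HodgeConjecture.HodgeConjecture.Theorems.F0P3cS2SharpOrgansOfS2Sharp   -- ★ p848004 «Cert» ED. 1: `s2Fin_of_S2sharp`, `s2PinCompact_of_S2sharp` (+ ★ #80 S2♯, ★ U♭-cot p847744, ★ `K_c` p819716, ★ K4 token, ★ `F0P3XiArchDataOfRecord`)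
import Summits.HodgeConjecture.HodgeConjecture.Theorems.F0P3cPinCompactChi            -- ★ p850169 (K1) «KOMPAKT»: letters `S2PinCompactLetter` ∕ `S2CasimirTauLetter`, `isCohTrivialAt_iff_sq_sum_eq_two`, `pinCompact_of_casimirTau`, `casimirTau_of_pinCompact`
import HarnessLib

/-!
# Crux `H413`, half A line LH1 — THE EQUIVALENCE CERTIFICATE for LEAF ED. 4 «Kompakt» of the pay-down of the closer stub `stub_S2sharp`:
# S2♯ (#80) ⟺ FIN ∧ CASIMIR-ι ∧ CASIMIR-τ, BY THEOREM, with the DIRECT head (no GLOBAL-ι^χ detour)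

Cell `hodgecm-mathlib` (D-0151), FLOOR 0, crux item H413 = `stmt-HodgeConjecture-24833` (`--supports`, helper), route of record `HCCMUnconditional`; half A line LH1,
prover LH1-p01 (g5), DEAL (C4) «CERT ED. 4» of LH1-plan (g4) 2026-09-02T07:52:39Z — the ED. 4 analogue of ★ «Cert» ED. 1 `F0P3cS2SharpOrgansOfS2Sharp` (p848004) and
★ «Cert» ED. 2 `F0P3cS2SharpOrgansOfS2SharpChi` (p849453, LH1-p04 (g3)).  Closed-`Prop` letters + theorems (no instance, no notation, no named fact, no `sorry`);
never imports a `Cruxes/…/Lines` module.  The two letters of this file carry PROSE locators (gate relocation rule for `def … : Prop` under `Theorems/`).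

THE OBJECTS.  LEAF `Cruxes/H413/Lines/F0_P3c_S2SharpPaydown.lean` ED. 4 «Kompakt» (sha16 ac97d3c1aa44bf02, LH1-plan (g4), commit fc134f815635) cuts the print
letter S2♯ ★ `Literature.NumberTheory.Rogawski1990.cohDiscrete_memXiFamily_archPinned` (#80) into three rung-5 PRINT organs FIN · CASIMIR-ι · CASIMIR-τ (sorries 3),
the CENTRAL halves of the old archimedean pins being PROVED in-house («ZENTRUM» ★ p850019∕p850109∕p850140 at `ι`, ★ p850069 + (K1) ★ p850169 at the compact `τ`).
THIS FILE is the kernel object for the desk's rule (f) «organs = #80's content modulo ★» at ED. 4: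
* §1 LETTERS `S2FinLetter` (FIN) and `S2CasimirIotaLetter` (CASIMIR-ι), restated BYTE-FOR-BYTE from the tree leaf ED. 4 (:101, :167); CASIMIR-τ and PIN-τ are the
  ★ (K1) letters `F0P3cPinCompactChi.S2CasimirTauLetter` ∕ `S2PinCompactLetter` BY NAME (themselves byte-identical to the leaf's :278 ∕ :248 — `Iff.rfl`, LH1-p01 (g5)
  by-import tie `TIE_leafED4_byimport_AGG` 2026-09-02T07:55Z), so nothing is restated twice under `Theorems/`.
* §2 (⟹) `s2Fin_of_S2sharp'` (= ★ ED. 1 read-back, re-typed at the letter), `s2CasimirIota_of_S2sharp` — S2♯'s pin at `ι` for ITS `ξ₀` (S2♯ applied at the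
  cohomological token ★ `exists_cohToken_of_isHolOrAntihol_cpt` of the cotangent `P`, its `K_c`-clause discharged by ★ p819716), moved to EVERY `ξ` of the family by
  U♭-cot ★ `memXiFamily_rigid_of_isCot`, then the residue arithmetic ★ (K1) `isCohTrivialAt_iff_sq_sum_eq_two … ι` (whose O-SPLIT∕CENTRAL inputs ★ p850109∕p850069 are
  inside) — the token binders of CASIMIR-ι are UNUSED hypotheses in this direction; `s2CasimirTau_of_S2sharp` = ★ (K1) `casimirTau_of_pinCompact` ∘ ★ ED. 1
  `s2PinCompact_of_S2sharp`; `organsKompakt_of_s2sharp` bundles the three.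
* §3 (⟸) `s2sharp_of_organsKompakt` — THE DIRECT HEAD: the `ξ` of FIN; at an embedding `ι′` over `ι`, CASIMIR-ι on S2♯'s OWN token `(M, σK, σ𝔤, T₁)` gives
  `a²+b²+c² = 2` for the triple of record at `ι`, ★ (K1) `isCohTrivialAt_iff_sq_sum_eq_two … ι` turns it into `ξ.IsCohTrivialAt (tOfArchType k₀ ι) ι` (NO χ-currency
  Wigner step, NO ★ p849137 — the proof-of-concept for a leaner leaf head), and ★ `archTypeOfRecord_eq` ∕ `odd_archTypeOfRecord` ∕ `isCohTrivialAt_of_mk_eq` transport it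
  to `ι′ ∈ {ι, ῑ}` exactly as the leaf head; off `ι`: ★ (K1) `pinCompact_of_casimirTau`.  The `δ ∕ H¹_δ ≠ ⊥` binders of #80 feed FIN only.
* §4 `s2sharp_iff_organsKompakt : S2♯ ↔ S2FinLetter ∧ S2CasimirIotaLetter ∧ S2CasimirTauLetter` — THE CERTIFICATE; `s2sharp_iff_organsKompakt.2 ⟨hFin, hCas, hTau⟩` is
  the hypothesis-free carrier `… : cohDiscrete_memXiFamily_archPinned` the day the three organs are ★.  With ★ ED. 1∕ED. 2 certificates and ★ (K1)
  `pinCompact_iff_casimirTau`: FIN ∧ CASIMIR-ι ∧ CASIMIR-τ ↔ S2♯ ↔ FIN ∧ PIN-ι ∧ PIN-τ ↔ FIN ∧ GLOBAL-ι^χ ∧ PIN-τ, all by theorem.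
Nothing printed is discharged: FIN ∕ CASIMIR-ι ∕ CASIMIR-τ stay rung-5 print ([Rogawski1990] Thm. 13.3.5, Thm. 13.3.6 (c), Thm. 14.6.4, §12.2–12.3; [KnappVogan1995]
Prop. 4.120 ∕ 11.43; [BorelWallach2000] II Prop. 6.12 (2)) — packet rigidity at the archimedean places + `MemXiFamily`, crux-sized, no prover organ.
HONEST LABEL: HC_CM is proved only modulo the 7 printed citations (2 remaining: hLiu418 = stmt-HodgeConjecture-24832, h413 = stmt-HodgeConjecture-24833) until
rung 0 closes; count-neutral (no books digit moves; #80 stays one UNPROVED row).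

References: [Rogawski1990] J. Rogawski, *Automorphic representations of unitary groups in three variables*, Ann. of Math. Stud. 123 (1990): §12.2 p. 174, §12.3
pp. 174–178 (`F_φ` p. 176, Prop. 12.3.3 p. 178), §13.1 p. 199, Thm. 13.3.5 and Thm. 13.3.6 (c) (p. 202), §14.6 pp. 241–244 (Thm. 14.6.4 p. 243), Prop. 15.2.1 (a)(b) and
§15.3 ¶1 (p. 249); [BorelWallach2000] A. Borel, N. Wallach, *Continuous cohomology, discrete subgroups, and representations of reductive groups*, 2nd ed. (2000): II
Prop. 6.12 (2), II Cor. 3.3, VI Thm. 4.11; [KnappVogan1995] A. Knapp, D. Vogan, *Cohomological induction and unitary representations* (1995), Prop. 4.120, Prop. 11.43;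
[Liu2021] Y. Liu, Camb. J. Math. 9 (2021), Remark 4.2.
-/

-- Mathlib idiom (as in ★ `F0P3cS2SharpOrgansOfS2Sharp`, ★ `CohDiscreteMemXiFamilyArchPinned`): commutator bracket on `Module.End ℂ M`, load-bearing for the
-- binder `(uFormGroup (Fin 2) (Fin 1)).lie →ₗ⁅ℝ⁆ Module.End ℂ M` of the token.
attribute [local instance 100] LieRing.ofAssociativeRing

set_option autoImplicit false
-- the mandated namespace has the single-problem summit's repeated segment (`HodgeConjecture.HodgeConjecture`)
set_option linter.dupNamespace false

noncomputable section

open NumberField IsDedekindDomain MeasureTheory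
open scoped Matrix ComplexOrder

namespace Summit.HodgeConjecture.HodgeConjecture.Cruxes.H413.F0P3cS2SharpOrgansOfS2SharpKompakt

open Literature.NumberTheory.Automorphic Literature.NumberTheory.Automorphic.UnitaryGroup
open Literature.NumberTheory.Automorphic.UnitaryGroup.CotangentForms
open Literature.NumberTheory.Automorphic.Arthur2013.Leaves.TECR
open Literature.NumberTheory.GaloisRepresentations
open Literature.NumberTheory.Rogawski1990
open Literature.RepresentationTheory.BorelWallach2000
open Literature.RepresentationTheory.KonnoKonno2007 Literature.RepresentationTheory.KonnoKonno2007.RealDualPair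
open Literature.RepresentationTheory.KonnoKonno2007.RealDualPair.UForm
open Summit.HodgeConjecture.HodgeConjecture.Cruxes.H413.F0P3XiArchDataOfRecord
open Summit.HodgeConjecture.HodgeConjecture.Cruxes.H413.F0P3cMemXiFamilyRigidOfCot (memXiFamily_rigid_of_isCot)
open Summit.HodgeConjecture.HodgeConjecture.Cruxes.H413.F0P3CompactTrivOfRecord (cmCompactFactor_rightRegular_eq_self_of_isHolOrAntihol)
open Summit.HodgeConjecture.HodgeConjecture.Cruxes.H413.F0P3SLayerFoldShapes (exists_cohToken_of_isHolOrAntihol_cpt)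
open Summit.HodgeConjecture.HodgeConjecture.Cruxes.H413.F0P3cS2SharpOrgansOfS2Sharp (s2Fin_of_S2sharp s2PinCompact_of_S2sharp)
open Summit.HodgeConjecture.HodgeConjecture.Cruxes.H413.F0P3cPinCompactChi
  (S2PinCompactLetter S2CasimirTauLetter isCohTrivialAt_iff_sq_sum_eq_two pinCompact_of_casimirTau casimirTau_of_pinCompact)

/-! ## §1 The two letters of this file (FIN and CASIMIR-ι, the leaf's texts byte for byte); CASIMIR-τ ∕ PIN-τ are ★ (K1)'s letters by name -/

/-- **LETTER FIN — the finite-place half of S2♯** (the organ `S2FinLetter` of the LH1 leaf `F0_P3c_S2SharpPaydown`, ED. 1 = ED. 4 text, restated byte for byte):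
under the letter's hypotheses on `P` (cotangent type at the CM frame, `K_c`-trivial, an irreducible `(𝔤,K)`-token at `ι` with a degree-one class of type `δ = ±1`)
there is a one-dimensional automorphic `ξ` of `H` with `MemXiFamily P … μω hμu ξ`.  PRINT ROAD (rung 5): a cotangent `P` is of type `(1, χ)` for a one-dimensional
`ξ` [Rogawski1990, §15.3 ¶1 (p. 249), Thm. 13.3.6 (c) (p. 202)], i.e. `P ∈ Π′(ξ)` [Rogawski1990, Thm. 14.6.4 (p. 243)], whose finite local components are the packets
`Π(ξ_v)` of ★ `MemXiFamily` [Rogawski1990, §13.1 p. 199, §12.2 p. 174, §4.13 Lemma 4.13.1 (b)]; [BorelWallach2000, VI Thm. 4.11]. -/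
def S2FinLetter : Prop :=
  ∀ (L : Type) [Field L] [NumberField L] [IsCMField L] (ι : L →+* ℂ) (H : Matrix (Fin 3) (Fin 3) L) (T : GL (Fin 3) ℂ)
    (hT : (T : Matrix (Fin 3) (Fin 3) ℂ)ᴴ * H.map ι * (T : Matrix (Fin 3) (Fin 3) ℂ) = Literature.Geometry.ComplexHyperbolic.BallModel.J),
    (∀ τ' : L →+* ℂ, InfinitePlace.mk τ' ≠ InfinitePlace.mk ι → (H.map τ').PosDef) →
    2 ≤ Module.finrank ℚ ↥(maximalRealSubfield L) →
    ∀ (μ : Measure (adelicGroupData (↥(maximalRealSubfield L)) L (IsCMField.complexConj L) 3 H).automorphicQuotient)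
      [(adelicGroupData (↥(maximalRealSubfield L)) L (IsCMField.complexConj L) 3 H).IsAutomorphicMeasure μ]
      (μω : HeckeCharacter L) (hμu : μω.IsUnitary),
      (∀ x : Literature.NumberTheory.GaloisRepresentations.ideleGroup ↥(maximalRealSubfield L),
        μω (AdeleRing.ideleBaseChange (↥(maximalRealSubfield L)) L x) = quadraticHeckeCharCM L x) →
    ∀ (P : DiscreteAutomorphicRep (adelicGroupData (↥(maximalRealSubfield L)) L (IsCMField.complexConj L) 3 H) μ),
      (P.IsHolCotangentAt (cmArchSection L ι H T hT) (cmCompactFactor L ι H T hT) ∨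
        P.IsAntiholCotangentAt (cmArchSection L ι H T hT) (cmCompactFactor L ι H T hT)) →
      (∀ k : (adelicGroupData (↥(maximalRealSubfield L)) L (IsCMField.complexConj L) 3 H).Adelic, k ∈ cmCompactFactor L ι H T hT →
        ∀ v : P.space.toSubmodule, (adelicGroupData (↥(maximalRealSubfield L)) L (IsCMField.complexConj L) 3 H).rightRegular μ k
          (v : (adelicGroupData (↥(maximalRealSubfield L)) L (IsCMField.complexConj L) 3 H).L2 μ) = v) →
      ∀ (M : Type) [AddCommGroup M] [Module ℂ M]
        (σK : Representation ℂ (uFormGroup (Fin 2) (Fin 1)).maximalCompact M) (σ𝔤 : (uFormGroup (Fin 2) (Fin 1)).lie →ₗ⁅ℝ⁆ Module.End ℂ M)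
        (hM : IsGKModule (uFormGroup (Fin 2) (Fin 1)) σK σ𝔤), IsIrreducibleGK σK σ𝔤 →
        (∃ T₁ : P.archModuleCM ι T hT →ₗ[ℂ] M,
          (∀ (k : (uFormGroup (Fin 2) (Fin 1)).maximalCompact) (w : P.archModuleCM ι T hT), T₁ (P.archRepKCM ι T hT k w) = σK k (T₁ w)) ∧
            (∀ (X : (uFormGroup (Fin 2) (Fin 1)).lie) (w : P.archModuleCM ι T hT), T₁ (P.archRepLieCM ι T hT X w) = σ𝔤 X (T₁ w)) ∧ T₁ ≠ 0) →
        ∀ δ : ℤ, (δ = 1 ∨ δ = -1) → upqTypeClasses σK σ𝔤 hM.ad_compat 1 δ ≠ ⊥ →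
          ∃ ξ : OneDimAutRepH L,
            MemXiFamily P (transpose_map_cmConjRingHom_eq_of_frame L ι H T hT) (isUnit_det_of_frame L ι H T hT) μω hμu ξ

/-- **LETTER CASIMIR-ι — the archimedean WEIGHT NORM of the family at the non-compact place** (the organ `S2CasimirIotaLetter` of the LH1 leaf ED. 3∕4, restated
byte for byte; GLOBAL-ι^χ's frame INCLUDING the token binders `(M, σK, σ𝔤, hM, irreducible, T₁ ≠ 0)`, no `K_c` clause, no `H¹_δ` clause): for a discrete `P` of
(anti)holomorphic cotangent type at the CM frame, every irreducible token, EVERY one-dimensional automorphic `ξ` with `MemXiFamily P … μω hμu ξ` and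
`(a,b,c) = rogTriple (ξ.pη ι) (ξ.qψ ι) (tOfArchType k₀ ι)`: `a² + b² + c² = 2` (the Casimir∕infinitesimal-character norm of `Π(ξ_ι)` is that of the trivial
representation).  With the in-house CENTRAL-ι identity `a + b + c = 0` («ZENTRUM») this is `{a,b,c} = {1,0,−1}`.  PRINT ROAD (rung 5): `P ∈ Π′(ξ)` [Rogawski1990,
Thm. 13.3.5 (p. 202), Thm. 14.6.4 (p. 243)]; `P_ι ∈ Π(φ(a,b,c))` [Rogawski1990, §12.3 pp. 174–178, Prop. 12.3.3 p. 178]; `P_ι` cohomological ⇒ Casimir `0`, while every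
member of `Π(φ(a,b,c))` has Casimir `a²+b²+c²−2` for the trace form [KnappVogan1995, Prop. 11.43, Prop. 4.120; BorelWallach2000, II Prop. 6.12 (2)]; [Liu2021, Remark 4.2]. -/
def S2CasimirIotaLetter : Prop :=
  ∀ (L : Type) [Field L] [NumberField L] [IsCMField L] (ι : L →+* ℂ) (H : Matrix (Fin 3) (Fin 3) L) (T : GL (Fin 3) ℂ)
    (hT : (T : Matrix (Fin 3) (Fin 3) ℂ)ᴴ * H.map ι * (T : Matrix (Fin 3) (Fin 3) ℂ) = Literature.Geometry.ComplexHyperbolic.BallModel.J),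
    (∀ τ' : L →+* ℂ, InfinitePlace.mk τ' ≠ InfinitePlace.mk ι → (H.map τ').PosDef) →
    2 ≤ Module.finrank ℚ ↥(maximalRealSubfield L) →
    ∀ (μ : Measure (adelicGroupData (↥(maximalRealSubfield L)) L (IsCMField.complexConj L) 3 H).automorphicQuotient)
      [(adelicGroupData (↥(maximalRealSubfield L)) L (IsCMField.complexConj L) 3 H).IsAutomorphicMeasure μ]
      (μω : HeckeCharacter L) (hμu : μω.IsUnitary),
      (∀ x : Literature.NumberTheory.GaloisRepresentations.ideleGroup ↥(maximalRealSubfield L),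
        μω (AdeleRing.ideleBaseChange (↥(maximalRealSubfield L)) L x) = quadraticHeckeCharCM L x) →
    ∀ (P : DiscreteAutomorphicRep (adelicGroupData (↥(maximalRealSubfield L)) L (IsCMField.complexConj L) 3 H) μ),
      (P.IsHolCotangentAt (cmArchSection L ι H T hT) (cmCompactFactor L ι H T hT) ∨
        P.IsAntiholCotangentAt (cmArchSection L ι H T hT) (cmCompactFactor L ι H T hT)) →
      ∀ (M : Type) [AddCommGroup M] [Module ℂ M]
        (σK : Representation ℂ (uFormGroup (Fin 2) (Fin 1)).maximalCompact M) (σ𝔤 : (uFormGroup (Fin 2) (Fin 1)).lie →ₗ⁅ℝ⁆ Module.End ℂ M)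
        (hM : IsGKModule (uFormGroup (Fin 2) (Fin 1)) σK σ𝔤), IsIrreducibleGK σK σ𝔤 →
        (∃ T₁ : P.archModuleCM ι T hT →ₗ[ℂ] M,
          (∀ (k : (uFormGroup (Fin 2) (Fin 1)).maximalCompact) (w : P.archModuleCM ι T hT), T₁ (P.archRepKCM ι T hT k w) = σK k (T₁ w)) ∧
            (∀ (X : (uFormGroup (Fin 2) (Fin 1)).lie) (w : P.archModuleCM ι T hT), T₁ (P.archRepLieCM ι T hT X w) = σ𝔤 X (T₁ w)) ∧ T₁ ≠ 0) →
        ∀ ξ : OneDimAutRepH L,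
          MemXiFamily P (transpose_map_cmConjRingHom_eq_of_frame L ι H T hT) (isUnit_det_of_frame L ι H T hT) μω hμu ξ →
            ∀ a b c : ℤ, ArchSignRecipe.rogTriple (ξ.pη ι) (ξ.qψ ι) (ArchSignRecipe.tOfArchType (archTypeOfRecord μω) ι) = (a, b, c) →
              a ^ 2 + b ^ 2 + c ^ 2 = 2

/-! ## §2 S2♯ ⟹ each organ (★ read-backs, U♭-cot, the cotangent `P`'s `K_c`-triviality and token, ★ (K1) residue arithmetic) -/

/-- **S2♯ ⟹ LETTER FIN** (★ ED. 1 read-back `s2Fin_of_S2sharp`, re-typed at this file's letter — the texts agree token for token).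
[cite: Rogawski1990, §14.6 Thm. 14.6.4 (p. 243); §15.3 ¶1 (p. 249); Thm. 13.3.6 (c) (p. 202)] -/
theorem s2Fin_of_S2sharp' (h : cohDiscrete_memXiFamily_archPinned) : S2FinLetter :=
  s2Fin_of_S2sharp h

/-- **S2♯ ⟹ LETTER CASIMIR-ι**: the cotangent `P` is fixed pointwise by `K_c` (★ p819716) and carries a cohomological `(𝔤,K)`-token of some type `δ = ±1`
(★ `exists_cohToken_of_isHolOrAntihol_cpt`), so S2♯ yields `ξ₀` with `MemXiFamily P … ξ₀` pinned at the type of record (★ `hasUnitaryArchType_archTypeOfRecord`) and at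
`ι`; the GIVEN `ξ` of the family equals `ξ₀` (U♭-cot ★ p847744 `memXiFamily_rigid_of_isCot`), and ★ (K1) `isCohTrivialAt_iff_sq_sum_eq_two … ι` reads the pin
`IsCohTrivialAt (tOfArchType k₀ ι) ι` as `a²+b²+c² = 2`.  The letter's own token binders are not used. [cite: Rogawski1990, Thm. 13.3.5 (p. 202); §14.6 Thm. 14.6.4 (p. 243); §12.3 p. 178; Prop. 15.2.1 (b) (p. 249)]
[cite: BorelWallach2000, II Prop. 6.12 (2)] -/
theorem s2CasimirIota_of_S2sharp (h : cohDiscrete_memXiFamily_archPinned) : S2CasimirIotaLetter := by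
  intro L _ _ _ ι H T hT hdef h2 μ _ μω hμu hμω P hP M _ _ σK σ𝔤 hM hirr htok ξ hmem a b c habc
  -- S2♯'s two extra hypotheses hold for a cotangent `P`: `K_c` fixes it pointwise, and it has a cohomological token of some type `δ = ±1`
  obtain ⟨M₀, _, _, σK₀, σ𝔤₀, hM₀, δ, hδ, hirr₀, htok₀, hne₀⟩ := exists_cohToken_of_isHolOrAntihol_cpt L ι H T hT μ hdef h2 P hP
  obtain ⟨ξ₀, hmem₀, hall⟩ := h L ι H T hT hdef h2 μ μω hμu hμω P hP
    (cmCompactFactor_rightRegular_eq_self_of_isHolOrAntihol L ι H T hT P hP) M₀ σK₀ σ𝔤₀ hM₀ hirr₀ htok₀ δ hδ hne₀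
  -- the given `ξ` of the family IS S2♯'s `ξ₀` (U♭ on the cotangent locus)
  have hξ : ξ = ξ₀ := memXiFamily_rigid_of_isCot ι H T hT hdef h2 μω hμu P hP ξ ξ₀ hmem hmem₀
  have hpin : ξ.IsCohTrivialAt (ArchSignRecipe.tOfArchType (archTypeOfRecord μω) ι) ι := by
    rw [hξ]
    exact hall (archTypeOfRecord μω) (hasUnitaryArchType_archTypeOfRecord μω hμu hμω) ι
  exact (isCohTrivialAt_iff_sq_sum_eq_two L ι H T hT hdef h2 μ μω hμu hμω P hP ξ hmem ι a b c habc).mp hpin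

/-- **S2♯ ⟹ LETTER CASIMIR-τ** = ★ (K1) `casimirTau_of_pinCompact` ∘ ★ ED. 1 `s2PinCompact_of_S2sharp` (PIN-τ from S2♯ by the same token∕U♭ move at `τ ≠ ι`).
[cite: Rogawski1990, §14.6 pp. 242–243 and Thm. 14.6.4 (p. 243); §12.3 pp. 176, 178; Thm. 13.3.5 (p. 202)] -/
theorem s2CasimirTau_of_S2sharp (h : cohDiscrete_memXiFamily_archPinned) : S2CasimirTauLetter :=
  casimirTau_of_pinCompact (s2PinCompact_of_S2sharp h)

/-- **S2♯ ⟹ FIN ∧ CASIMIR-ι ∧ CASIMIR-τ** (§2 bundled). [cite: Rogawski1990, §14.6 Thm. 14.6.4 (p. 243); Thm. 13.3.5 and Thm. 13.3.6 (c) (p. 202); §12.3 pp. 174–178] -/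
theorem organsKompakt_of_s2sharp (h : cohDiscrete_memXiFamily_archPinned) :
    S2FinLetter ∧ S2CasimirIotaLetter ∧ S2CasimirTauLetter :=
  ⟨s2Fin_of_S2sharp' h, s2CasimirIota_of_S2sharp h, s2CasimirTau_of_S2sharp h⟩

/-! ## §3 FIN ∧ CASIMIR-ι ∧ CASIMIR-τ ⟹ S2♯ — the DIRECT head (★ (K1) at `ι` on S2♯'s own token; ★ (K1) `pinCompact_of_casimirTau` off `ι`) -/

/-- **ORGANS ⟹ S2♯, DIRECT HEAD**: the `ξ` of FIN (fed by all of #80's binders, including `δ` and `H¹_δ ≠ ⊥`); for a unitary type `k` of `μω`, `k = k₀` (★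
`archTypeOfRecord_eq`) with every `k₀ w` odd (★ `odd_archTypeOfRecord`); at an embedding `ι′` over `ι`: CASIMIR-ι on #80's OWN token `(M, σK, σ𝔤, T₁ ≠ 0)` gives
`a²+b²+c² = 2` for the triple of record at `ι`, ★ (K1) `isCohTrivialAt_iff_sq_sum_eq_two … ι` turns it into `ξ.IsCohTrivialAt (tOfArchType k₀ ι) ι` (no χ-currency Wigner
step), and ★ `isCohTrivialAt_of_mk_eq` transports it to `ι′ ∈ {ι, ῑ}` (`t ↦ −t−1`); at an embedding off `ι`: PIN-τ = ★ (K1) `pinCompact_of_casimirTau` of CASIMIR-τ.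
[cite: Rogawski1990, §14.6 Thm. 14.6.4 (p. 243) and pp. 242–243; §12.3 pp. 174–178; Prop. 15.2.1 (b) (p. 249)] [cite: Liu2021, Remark 4.2] -/
theorem s2sharp_of_organsKompakt (hFin : S2FinLetter) (hCas : S2CasimirIotaLetter) (hTau : S2CasimirTauLetter) :
    cohDiscrete_memXiFamily_archPinned := by
  have hCpt : S2PinCompactLetter := pinCompact_of_casimirTau hTau
  intro L _ _ _ ι H T hT hdef h2 μ _ μω hμu hμω P hP hKc M _ _ σK σ𝔤 hM hirr htok δ hδ hne
  obtain ⟨ξ, hmem⟩ := hFin L ι H T hT hdef h2 μ μω hμu hμω P hP hKc M σK σ𝔤 hM hirr htok δ hδ hne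
  refine ⟨ξ, hmem, fun k hk ι' => ?_⟩
  have hk₀ : archTypeOfRecord μω = k := archTypeOfRecord_eq hμu hk
  have hodd : ∀ w : InfinitePlace L, Odd (k w) := fun w => hk₀ ▸ odd_archTypeOfRecord μω hμu hμω w
  by_cases hι' : InfinitePlace.mk ι' = InfinitePlace.mk ι
  · -- over the place of `ι`: CASIMIR-ι on #80's own token, read as the pin at `ι` by ★ (K1), transported to `ι′ ∈ {ι, ῑ}`
    have hsq := hCas L ι H T hT hdef h2 μ μω hμu hμω P hP M σK σ𝔤 hM hirr htok ξ hmem _ _ _ rfl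
    have hι : ξ.IsCohTrivialAt (ArchSignRecipe.tOfArchType (archTypeOfRecord μω) ι) ι :=
      (isCohTrivialAt_iff_sq_sum_eq_two L ι H T hT hdef h2 μ μω hμu hμω P hP ξ hmem ι _ _ _ rfl).mpr hsq
    rw [hk₀] at hι
    exact isCohTrivialAt_of_mk_eq ξ k hodd ι hι ι' hι'
  · -- a compact embedding: PIN-τ (★ (K1) from CASIMIR-τ)
    have h := hCpt L ι H T hT hdef h2 μ μω hμu hμω P hP hKc ξ hmem ι' hι'
    rwa [hk₀] at h

/-! ## §4 THE CERTIFICATE -/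

/-- **THE EQUIVALENCE CERTIFICATE FOR LEAF ED. 4 «Kompakt»** — the print letter #80 S2♯ ★ `cohDiscrete_memXiFamily_archPinned` is EQUIVALENT to the conjunction of
the leaf's three organs FIN ∧ CASIMIR-ι ∧ CASIMIR-τ (texts token for token), modulo the in-house ★ facts of §2–§3 (`K_c`-triviality and the cohomological token of a
cotangent `P`, U♭ on the cotangent locus, the unitary archimedean type of record of `μω`, and the «ZENTRUM»∕«KOMPAKT» residue arithmetic ★ (K1) over ★ p850069∕p850109):
the desk's rule (f) «organs = #80's content modulo ★» for ED. 4, as a kernel object.  Nothing printed is discharged.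
[cite: Rogawski1990, §14.6 Thm. 14.6.4 (p. 243) and pp. 242–243; Thm. 13.3.5 and Thm. 13.3.6 (c) (p. 202); §12.3 pp. 174–178 (Prop. 12.3.3 p. 178); Prop. 15.2.1 (b) (p. 249); §13.1 p. 199]
[cite: KnappVogan1995, Prop. 4.120; Prop. 11.43] [cite: BorelWallach2000, II Prop. 6.12 (2); VI Thm. 4.11] [cite: Liu2021, Remark 4.2] -/
theorem s2sharp_iff_organsKompakt :
    cohDiscrete_memXiFamily_archPinned ↔ (S2FinLetter ∧ S2CasimirIotaLetter ∧ S2CasimirTauLetter) :=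
  ⟨organsKompakt_of_s2sharp, fun h => s2sharp_of_organsKompakt h.1 h.2.1 h.2.2⟩

/-- **ED. 4 ≡ ED. 1 at the organ level, by theorem**: FIN ∧ CASIMIR-ι ∧ CASIMIR-τ ⟺ FIN ∧ CASIMIR-ι ∧ PIN-τ (★ (K1) `pinCompact_iff_casimirTau` on the third
conjunct) — recorded so that a reader holding the ED. 1∕2 certificates can chain them without opening (K1). [cite: Rogawski1990, §14.6 pp. 242–243; §12.3 pp. 176–178] -/
theorem organsKompakt_iff_organsPin :
    (S2FinLetter ∧ S2CasimirIotaLetter ∧ S2CasimirTauLetter) ↔ (S2FinLetter ∧ S2CasimirIotaLetter ∧ S2PinCompactLetter) :=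
  ⟨fun h => ⟨h.1, h.2.1, pinCompact_of_casimirTau h.2.2⟩, fun h => ⟨h.1, h.2.1, casimirTau_of_pinCompact h.2.2⟩⟩

end Summit.HodgeConjecture.HodgeConjecture.Cruxes.H413.F0P3cS2SharpOrgansOfS2SharpKompakt

end
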